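import Summits.CriticalPhenomena.SAWScalingLimit.Theses.SAWTotalPositivity
import Summits.CriticalPhenomena.SAWScalingLimit.Theorems.SAWTotalPositivityBoundaryTP2Defs
import Summits.CriticalPhenomena.SAWScalingLimit.Theorems.SAWTotalPositivityBoundaryTP2Kernel
import Summits.CriticalPhenomena.SAWScalingLimit.Theorems.SAWTotalPositivityBoundaryTP2Symmetry
import Summits.CriticalPhenomena.SAWScalingLimit.Theorems.SAWTotalPositivityBoundaryTP2LadderAlternate
import Summits.CriticalPhenomena.SAWScalingLimit.Theorems.SAWTotalPositivityBoundaryTP2LadderCcw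
import Summits.CriticalPhenomena.SAWScalingLimit.Theorems.EdgeOfPositivity.Negative.EdgeOfPositivityRectDomain
import Literature.Probability.RandomPlanarGeometry.SelfAvoidingWalkProofs
import HarnessLib

/-!
# Crux `BoundaryTP2` (stmt-CriticalPhenomena-7115): the crux AS TYPED holds on EVERY ladder domain

Line `Sketch`, lead c5 (final assembly, part 2).  `BoundaryTP2` asserts, for every bounded simply connected
`Ω ⊂ ℂ`, `δ > 0` and every interlaced, disjointly realisable quadruple of `Ω_δ`, the TP₂ inequality
`Z(p₁,p₃)Z(p₂,p₄) ≤ Z(p₁,p₂)Z(p₃,p₄)` at `x_c`.  Here it is PROVED for the infinite family of ladder domains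
`Ω = rectDomain L 1` (discrete domain `{0,…,L} × {0,1}` at mesh `1`), every `L`, every quadruple
(`boundaryTP2_on_ladders`): the hypotheses force pairwise distinct ladder sites whose pairs `{p₁,p₃}`, `{p₂,p₄}`
alternate along the boundary cycle (`stub_ladder_alternate`); the Klein symmetries of the conclusion reduce to a
counter-clockwise quadruple, settled by `ladder_ccw_general` at every fugacity `x ≤ 1/2 ≥ x_c`.
-/

noncomputable section

namespace Summit.CriticalPhenomena.SAWScalingLimit.Theorems.BoundaryTP2

open Literature.Probability.LatticeModels Literature.Probability.RandomPlanarGeometry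
open Summit.CriticalPhenomena.SAWScalingLimit.Theorems.EdgeOfPositivity.Negative
open scoped ENNReal

/-- Positions are injective on ladder sites: equal positions force equal sites. [folklore] -/
private theorem ladder_pos_injective {L : ℕ} {p q : Site 2} (hp : p ∈ rectSites L 1) (hq : q ∈ rectSites L 1)
    (h : (if p 1 = 0 then p 0 else 2 * L + 1 - p 0) = (if q 1 = 0 then q 0 else 2 * L + 1 - q 0)) : p = q := by
  obtain ⟨c, hc, rfl | rfl⟩ := ladder_site_cases hp <;>
  obtain ⟨c', hc', rfl | rfl⟩ := ladder_site_cases hq <;>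
  simp only [st_zero, st_one, if_true, one_ne_zero, if_false] at h
  · have : c = c' := by omega
    rw [this]
  · omega
  · omega
  · have : c = c' := by omega
    rw [this]

/-- The alternation step when `pos p₁ < pos p₃`: from `ladder_ccw_general` in the four possible cyclic
arrangements. [folklore] -/
private theorem ladder_tp2_of_alternate_lt (L : ℕ) {p₁ p₂ p₃ p₄ : Site 2}
    (hp₁ : p₁ ∈ rectSites L 1) (hp₂ : p₂ ∈ rectSites L 1) (hp₃ : p₃ ∈ rectSites L 1) (hp₄ : p₄ ∈ rectSites L 1)
    (h₁₂ : p₁ ≠ p₂) (h₁₄ : p₁ ≠ p₄) (h₂₃ : p₂ ≠ p₃) (h₃₄ : p₃ ≠ p₄)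
    (h13 : (if p₁ 1 = 0 then p₁ 0 else 2 * L + 1 - p₁ 0) < (if p₃ 1 = 0 then p₃ 0 else 2 * L + 1 - p₃ 0))
    (halt : ((if p₁ 1 = 0 then p₁ 0 else 2 * L + 1 - p₁ 0) < (if p₂ 1 = 0 then p₂ 0 else 2 * L + 1 - p₂ 0) ∧
        (if p₂ 1 = 0 then p₂ 0 else 2 * L + 1 - p₂ 0) < (if p₃ 1 = 0 then p₃ 0 else 2 * L + 1 - p₃ 0)) ↔
      ¬ ((if p₁ 1 = 0 then p₁ 0 else 2 * L + 1 - p₁ 0) < (if p₄ 1 = 0 then p₄ 0 else 2 * L + 1 - p₄ 0) ∧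
        (if p₄ 1 = 0 then p₄ 0 else 2 * L + 1 - p₄ 0) < (if p₃ 1 = 0 then p₃ 0 else 2 * L + 1 - p₃ 0)))
    {x : ℝ} (hx0 : 0 ≤ x) (hx : x ≤ 1 / 2) :
    pathKernel (discreteDomainGraph (rectDomain L 1) 1) x p₁ p₃ *
        pathKernel (discreteDomainGraph (rectDomain L 1) 1) x p₂ p₄ ≤
      pathKernel (discreteDomainGraph (rectDomain L 1) 1) x p₁ p₂ *
        pathKernel (discreteDomainGraph (rectDomain L 1) 1) x p₃ p₄ := by
  set R := discreteDomainGraph (rectDomain L 1) 1 with hR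
  set P : Site 2 → ℤ := fun p => if p 1 = 0 then p 0 else 2 * L + 1 - p 0 with hP
  have n12 : P p₁ ≠ P p₂ := fun h => h₁₂ (ladder_pos_injective hp₁ hp₂ h)
  have n14 : P p₁ ≠ P p₄ := fun h => h₁₄ (ladder_pos_injective hp₁ hp₄ h)
  have n23 : P p₂ ≠ P p₃ := fun h => h₂₃ (ladder_pos_injective hp₂ hp₃ h)
  have n34 : P p₃ ≠ P p₄ := fun h => h₃₄ (ladder_pos_injective hp₃ hp₄ h)
  change P p₁ < P p₃ at h13
  change (P p₁ < P p₂ ∧ P p₂ < P p₃) ↔ ¬ (P p₁ < P p₄ ∧ P p₄ < P p₃) at halt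
  by_cases hA : P p₁ < P p₂ ∧ P p₂ < P p₃
  · have hB : ¬ (P p₁ < P p₄ ∧ P p₄ < P p₃) := halt.1 hA
    rcases lt_or_gt_of_ne n14 with h14 | h41
    · -- p₁ < p₂ < p₃ < p₄ : N1 of (p₁,p₂,p₃,p₄)
      have h34' : P p₃ < P p₄ := by
        rcases lt_or_gt_of_ne n34 with h | h
        · exact h
        · exact absurd ⟨h14, h⟩ hB
      exact (ladder_ccw_general L hp₁ hp₂ hp₃ hp₄ hA.1 hA.2 h34' hx0 hx).1
    · -- p₄ < p₁ < p₂ < p₃ : N2 of (p₄,p₁,p₂,p₃)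
      have h := (ladder_ccw_general L hp₄ hp₁ hp₂ hp₃ h41 hA.1 hA.2 hx0 hx).2
      -- h : Z p₄ p₂ * Z p₁ p₃ ≤ Z p₄ p₃ * Z p₁ p₂
      rw [pathKernel_comm R x p₄ p₂, pathKernel_comm R x p₄ p₃] at h
      calc pathKernel R x p₁ p₃ * pathKernel R x p₂ p₄
          = pathKernel R x p₂ p₄ * pathKernel R x p₁ p₃ := mul_comm _ _
        _ ≤ pathKernel R x p₃ p₄ * pathKernel R x p₁ p₂ := h
        _ = pathKernel R x p₁ p₂ * pathKernel R x p₃ p₄ := mul_comm _ _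
  · have hB : P p₁ < P p₄ ∧ P p₄ < P p₃ := by
      by_contra h
      exact hA (halt.2 h)
    rcases lt_or_gt_of_ne n12 with h12 | h21
    · -- then p₂ > p₃ (else hA): p₁ < p₄ < p₃ < p₂ : N2 of (p₁,p₄,p₃,p₂)
      have h32 : P p₃ < P p₂ := by
        rcases lt_or_gt_of_ne n23 with h | h
        · exact absurd ⟨h12, h⟩ hA
        · exact h
      have h := (ladder_ccw_general L hp₁ hp₄ hp₃ hp₂ hB.1 hB.2 h32 hx0 hx).2
      -- h : Z p₁ p₃ * Z p₄ p₂ ≤ Z p₁ p₂ * Z p₄ p₃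
      rw [pathKernel_comm R x p₄ p₂, pathKernel_comm R x p₄ p₃] at h
      exact h
    · -- p₂ < p₁ < p₄ < p₃ : N1 of (p₂,p₁,p₄,p₃)
      have h := (ladder_ccw_general L hp₂ hp₁ hp₄ hp₃ h21 hB.1 hB.2 hx0 hx).1
      -- h : Z p₂ p₄ * Z p₁ p₃ ≤ Z p₂ p₁ * Z p₄ p₃
      rw [pathKernel_comm R x p₂ p₁, pathKernel_comm R x p₄ p₃] at h
      calc pathKernel R x p₁ p₃ * pathKernel R x p₂ p₄
          = pathKernel R x p₂ p₄ * pathKernel R x p₁ p₃ := mul_comm _ _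
        _ ≤ pathKernel R x p₁ p₂ * pathKernel R x p₃ p₄ := h

/-- **Graph level: every interlaced quadruple of every ladder.** For pairwise distinct sites of the ladder
`{0..L}×{0,1}` whose pairs `{p₁,p₃}`, `{p₂,p₄}` alternate along the boundary cycle (the conclusion of
`stub_ladder_alternate`) and `0 ≤ x ≤ 1/2`: `Z(p₁,p₃)Z(p₂,p₄) ≤ Z(p₁,p₂)Z(p₃,p₄)`. [folklore] -/
theorem ladder_tp2_of_alternate (L : ℕ) {p₁ p₂ p₃ p₄ : Site 2}
    (hp₁ : p₁ ∈ rectSites L 1) (hp₂ : p₂ ∈ rectSites L 1) (hp₃ : p₃ ∈ rectSites L 1) (hp₄ : p₄ ∈ rectSites L 1)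
    (h₁₂ : p₁ ≠ p₂) (h₁₃ : p₁ ≠ p₃) (h₁₄ : p₁ ≠ p₄) (h₂₃ : p₂ ≠ p₃) (h₃₄ : p₃ ≠ p₄)
    (halt : (min (if p₁ 1 = 0 then p₁ 0 else 2 * L + 1 - p₁ 0) (if p₃ 1 = 0 then p₃ 0 else 2 * L + 1 - p₃ 0) <
          (if p₂ 1 = 0 then p₂ 0 else 2 * L + 1 - p₂ 0) ∧
        (if p₂ 1 = 0 then p₂ 0 else 2 * L + 1 - p₂ 0) <
          max (if p₁ 1 = 0 then p₁ 0 else 2 * L + 1 - p₁ 0) (if p₃ 1 = 0 then p₃ 0 else 2 * L + 1 - p₃ 0)) ↔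
      ¬ (min (if p₁ 1 = 0 then p₁ 0 else 2 * L + 1 - p₁ 0) (if p₃ 1 = 0 then p₃ 0 else 2 * L + 1 - p₃ 0) <
          (if p₄ 1 = 0 then p₄ 0 else 2 * L + 1 - p₄ 0) ∧
        (if p₄ 1 = 0 then p₄ 0 else 2 * L + 1 - p₄ 0) <
          max (if p₁ 1 = 0 then p₁ 0 else 2 * L + 1 - p₁ 0) (if p₃ 1 = 0 then p₃ 0 else 2 * L + 1 - p₃ 0)))
    {x : ℝ} (hx0 : 0 ≤ x) (hx : x ≤ 1 / 2) :
    pathKernel (discreteDomainGraph (rectDomain L 1) 1) x p₁ p₃ *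
        pathKernel (discreteDomainGraph (rectDomain L 1) 1) x p₂ p₄ ≤
      pathKernel (discreteDomainGraph (rectDomain L 1) 1) x p₁ p₂ *
        pathKernel (discreteDomainGraph (rectDomain L 1) 1) x p₃ p₄ := by
  set R := discreteDomainGraph (rectDomain L 1) 1 with hR
  set P : Site 2 → ℤ := fun p => if p 1 = 0 then p 0 else 2 * L + 1 - p 0 with hP
  change (min (P p₁) (P p₃) < P p₂ ∧ P p₂ < max (P p₁) (P p₃)) ↔
    ¬ (min (P p₁) (P p₃) < P p₄ ∧ P p₄ < max (P p₁) (P p₃)) at halt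
  have n13 : P p₁ ≠ P p₃ := fun h => h₁₃ (ladder_pos_injective hp₁ hp₃ h)
  rcases lt_or_gt_of_ne n13 with h13 | h31
  · rw [min_eq_left h13.le, max_eq_right h13.le] at halt
    exact ladder_tp2_of_alternate_lt L hp₁ hp₂ hp₃ hp₄ h₁₂ h₁₄ h₂₃ h₃₄ h13 halt hx0 hx
  · rw [min_eq_right h31.le, max_eq_left h31.le] at halt
    -- apply the `<` case to (p₃, p₄, p₁, p₂)
    have halt' : (P p₃ < P p₄ ∧ P p₄ < P p₁) ↔ ¬ (P p₃ < P p₂ ∧ P p₂ < P p₁) := by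
      constructor
      · intro h h'
        exact (halt.1 h') h
      · intro h
        by_contra h'
        exact h (halt.2 h')
    have h := ladder_tp2_of_alternate_lt L hp₃ hp₄ hp₁ hp₂ h₃₄ h₂₃.symm h₁₄.symm h₁₂ h31 halt' hx0 hx
    -- h : Z p₃ p₁ * Z p₄ p₂ ≤ Z p₃ p₄ * Z p₁ p₂
    rw [pathKernel_comm R x p₃ p₁, pathKernel_comm R x p₄ p₂] at h
    calc pathKernel R x p₁ p₃ * pathKernel R x p₂ p₄
        ≤ pathKernel R x p₃ p₄ * pathKernel R x p₁ p₂ := h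
      _ = pathKernel R x p₁ p₂ * pathKernel R x p₃ p₄ := mul_comm _ _

/-- An endpoint of a self-avoiding path between distinct sites of the ladder lies in the ladder. [folklore] -/
private theorem ladder_mem_of_path {L : ℕ} {a b : Site 2}
    (P : (discreteDomainGraph (rectDomain L 1) 1).Path a b) (hab : a ≠ b) : a ∈ rectSites L 1 := by
  obtain ⟨u, hu⟩ := exists_adj_of_walk_ne P.1 hab
  exact (adj_rect_iff.1 hu).2.1

/-- **The crux `BoundaryTP2` restricted to the ladder domains is a theorem.** For every `L`, with
`Ω = rectDomain L 1` (discrete domain `{0,…,L} × {0,1}`) and mesh `1`, the statement of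
`Summit.CriticalPhenomena.SAWScalingLimit.Theses.SAWTotalPositivity.BoundaryTP2` holds for every quadruple: if every
SAW `p₁ → p₃` meets every SAW `p₂ → p₄` and the pairings `(p₁p₂|p₃p₄)`, `(p₁p₄|p₂p₃)` are realisable by vertex-disjoint
SAWs, then `Z(p₁,p₃)Z(p₂,p₄) ≤ Z(p₁,p₂)Z(p₃,p₄)` at `x_c`. [folklore] -/
theorem boundaryTP2_on_ladders (L : ℕ) (p₁ p₂ p₃ p₄ : Site 2)
    (hI : ∀ (P : SAW.DomainSAW (rectDomain L 1) 1 p₁ p₃) (Q : SAW.DomainSAW (rectDomain L 1) 1 p₂ p₄),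
      ∃ v, v ∈ P.walk.support ∧ v ∈ Q.walk.support)
    (hD₁ : ∃ (P : SAW.DomainSAW (rectDomain L 1) 1 p₁ p₂) (Q : SAW.DomainSAW (rectDomain L 1) 1 p₃ p₄),
      List.Disjoint P.walk.support Q.walk.support)
    (hD₂ : ∃ (P : SAW.DomainSAW (rectDomain L 1) 1 p₁ p₄) (Q : SAW.DomainSAW (rectDomain L 1) 1 p₂ p₃),
      List.Disjoint P.walk.support Q.walk.support) :
    SAW.weight (rectDomain L 1) 1 p₁ p₃ Set.univ * SAW.weight (rectDomain L 1) 1 p₂ p₄ Set.univ ≤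
      SAW.weight (rectDomain L 1) 1 p₁ p₂ Set.univ * SAW.weight (rectDomain L 1) 1 p₃ p₄ Set.univ := by
  -- graph-level hypotheses
  have hI' : Interlaced (discreteDomainGraph (rectDomain L 1) 1) p₁ p₂ p₃ p₄ := interlaced_of_domainSAW hI
  have hD₁' : DisjointPaths (discreteDomainGraph (rectDomain L 1) 1) p₁ p₂ p₃ p₄ := disjointPaths_of_domainSAW hD₁
  have hD₂' : DisjointPaths (discreteDomainGraph (rectDomain L 1) 1) p₁ p₄ p₂ p₃ := disjointPaths_of_domainSAW hD₂
  obtain ⟨h12, h13, h14, h23, h24, h34⟩ := pairwise_ne_of_disjointPaths hD₁' hD₂'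
  -- all four sites lie in the ladder
  obtain ⟨P, Q, -⟩ := hD₁'
  obtain ⟨P', Q', -⟩ := hD₂'
  have hp₁ : p₁ ∈ rectSites L 1 := ladder_mem_of_path P h12
  have hp₂ : p₂ ∈ rectSites L 1 := ladder_mem_of_path ⟨P.1.reverse, P.2.reverse⟩ h12.symm
  have hp₃ : p₃ ∈ rectSites L 1 := ladder_mem_of_path Q h34
  have hp₄ : p₄ ∈ rectSites L 1 := ladder_mem_of_path ⟨Q.1.reverse, Q.2.reverse⟩ h34.symm
  -- alternation along the boundary cycle, then the graph-level theorem at `x_c ≤ 1/2`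
  have halt := stub_ladder_alternate L hp₁ hp₂ hp₃ hp₄ h12 h13 h14 h23 h24 h34 hI'
  simp only [weight_univ_eq_pathKernel]
  exact ladder_tp2_of_alternate L hp₁ hp₂ hp₃ hp₄ h12 h13 h14 h23 h34 halt
    SAW.criticalFugacity_pos_lt_one'.1.le SAW.criticalFugacity_le_half

/-- The same, in the exact binder shape of the crux (the three extra hypotheses — boundedness, simple
connectivity, positive mesh — are facts for the ladder and are not needed): `BoundaryTP2` holds for every
`Ω ∈ {rectDomain L 1 : L ∈ ℕ}` at `δ = 1`. [folklore] -/
theorem boundaryTP2_on_ladders' (L : ℕ) :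
    ∀ (p₁ p₂ p₃ p₄ : Site 2), Bornology.IsBounded (rectDomain L 1) → SimplyConnectedSpace (rectDomain L 1) →
      (0 : ℝ) < 1 →
      (∀ (P : SAW.DomainSAW (rectDomain L 1) 1 p₁ p₃) (Q : SAW.DomainSAW (rectDomain L 1) 1 p₂ p₄),
        ∃ v, v ∈ P.walk.support ∧ v ∈ Q.walk.support) →
      (∃ (P : SAW.DomainSAW (rectDomain L 1) 1 p₁ p₂) (Q : SAW.DomainSAW (rectDomain L 1) 1 p₃ p₄),
        List.Disjoint P.walk.support Q.walk.support) →
      (∃ (P : SAW.DomainSAW (rectDomain L 1) 1 p₁ p₄) (Q : SAW.DomainSAW (rectDomain L 1) 1 p₂ p₃),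
        List.Disjoint P.walk.support Q.walk.support) →
      SAW.weight (rectDomain L 1) 1 p₁ p₃ Set.univ * SAW.weight (rectDomain L 1) 1 p₂ p₄ Set.univ ≤
        SAW.weight (rectDomain L 1) 1 p₁ p₂ Set.univ * SAW.weight (rectDomain L 1) 1 p₃ p₄ Set.univ :=
  fun p₁ p₂ p₃ p₄ _ _ _ hI hD₁ hD₂ => boundaryTP2_on_ladders L p₁ p₂ p₃ p₄ hI hD₁ hD₂

end Summit.CriticalPhenomena.SAWScalingLimit.Theorems.BoundaryTP2
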